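import Mathlib
import HarnessLib
import Literature.Analysis.FluidPDE.TypeIAncientMildTimeAnalytic
import Literature.Analysis.FluidPDE.OseenMildUniqueness
import Summits.NavierStokesRegularity.NavierStokesRegularity.Theorems.PoloidalWindowDoorPoloidalWindowRigidityWindow
import Summits.NavierStokesRegularity.NavierStokesRegularity.Theorems.PoloidalWindowDoorPoloidalWindowRigidityK2OfLrcSlope
import Summits.NavierStokesRegularity.NavierStokesRegularity.Theorems.PoloidalWindowDoorPoloidalWindowRigidityLeafUniformPins
import Summits.NavierStokesRegularity.NavierStokesRegularity.Theorems.PoloidalWindowDoorPoloidalWindowRigidityHotHullCompactness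
import Summits.NavierStokesRegularity.NavierStokesRegularity.Theorems.PoloidalWindowDoorPoloidalWindowRigidityConstantShearSlice

/-!
# Item `LrcModEntire` (stmt-NavierStokesRegularity-20428), registry twist_split v7 — A z-FLAT SLAB KILLS THE PROFILE (memo `Cruxes/LrcModEntire/T2B-g14.md` §14d):
# the first branch of the hyperbolic layer theorem is EMPTY against the window pin `(∂_z v)ₕ ≠ 0`

LEAD of item 20428 ns-poloidal-K2-p3 g14 (`--supports stmt-NavierStokesRegularity-20428 --as helper`).  If the vertical shear of the slice `v(−1,·)` of a class profile vanishes on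
a slab round the thread plane — `∂₂v_b(−1,x) = 0` for `|x₂|` small, `b ≠ 2`, the first alternative of `…TwistingTHHyperbolicLayer.slope_dichotomy_of_hotPoint` — then:
(1) `∂₂v_b(−1,·) ≡ 0` on ℝ³ for `b ≠ 2` (real-analyticity of the slice, `…K2OfLrcSlope.analyticOnNhd_uncurry_fderiv_entry`, identity theorem);
(2) by incompressibility (`…ConstantShearSlice.div_coord`) `∂₂v₂(−1,·)` is constant on vertical lines, so `v₂(−1,·)` is affine on them and, being bounded (Type-I decay), constant:
    **the slice `v(−1,·)` is invariant under vertical translations**;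
(3) the vertical translate `v(t, x + h e₂)` is a class profile (`…LeafUniformPins.class_translate`) with the SAME slice at `t = −1`, so forward uniqueness of bounded Oseen-mild
    solutions (`Literature…oseenMild_bounded_unique`, [GIM]/KNSS) identifies it with `v` on `(−1, −1/2)`, and REAL-ANALYTICITY IN TIME of the class
    (`Literature…IsTypeIAncientMild.analyticOnNhd_time`, Lemarié-Rieusset Thm 9.12) on the whole of `t < 0`;
(4) hence `∂₂v(t,·) ≡ 0` for every `t < 0`, contradicting the window pin `(∂₂v)₀ ≠ 0 ∨ (∂₂v)₁ ≠ 0` at any point of `W`.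

* `false_of_flatSlab` — class clauses + ONE point `(t₀, x₀)`, `t₀ < 0`, with `(∂₂v(t₀))₀(x₀) ≠ 0 ∨ (∂₂v(t₀))₁(x₀) ≠ 0` + the flat slab ⇒ `False`.
So the sub-cell «`μ₀ = 0`, `μ(−1,·) ≡ 0`» of `stub_T2b` is EMPTY by name; with `…HyperbolicLayer` the survivor of the (TH) column has `μ(−1,z) < 0` for all small `z ≠ 0`.

WHAT THIS IS NOT: not a claim about Navier–Stokes regularity and not a proof of `stub_T2b` (bears_on LADDER-NS N0, item 20428 / crux 19708; both OPEN, ⟨27893⟩ OPEN).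
-/

set_option linter.style.longLine false
set_option linter.dupNamespace false

namespace Summit.NavierStokesRegularity.NavierStokesRegularity.Theorems.PoloidalWindowDoorLrcModEntireTwistingTHFlatSlab

open Set Function Filter Topology Metric MeasureTheory
open scoped RealInnerProductSpace InnerProductSpace ContDiff
open Literature.Analysis Literature.Analysis.FluidPDE Literature.Analysis.UnboundedOperators
open Summit.NavierStokesRegularity.NavierStokesRegularity.Theorems
open Summit.NavierStokesRegularity.NavierStokesRegularity.Theorems.PoloidalWindowDoorPoloidalWindowRigidityWindow
open Summit.NavierStokesRegularity.NavierStokesRegularity.Theorems.PoloidalWindowDoorPoloidalWindowRigidityK2OfLrcSlope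
open Summit.NavierStokesRegularity.NavierStokesRegularity.Theorems.PoloidalWindowDoorPoloidalWindowRigidityLeafUniformPins
open Summit.NavierStokesRegularity.NavierStokesRegularity.Theorems.PoloidalWindowDoorPoloidalWindowRigidityConstantShearSlice
open Summit.NavierStokesRegularity.NavierStokesRegularity.Theorems.PoloidalWindowDoorPoloidalWindowRigidityHotHullCompactness

variable {C : ℝ} {v : ℝ → EuclideanSpace ℝ (Fin 3) → EuclideanSpace ℝ (Fin 3)}

/-- Derivative along the vertical line for a vector field: `z ↦ w(x + z e₂)` has derivative `Dw(x + z e₂) e₂`. -/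
theorem hasDerivAt_vertical_vec {w : EuclideanSpace ℝ (Fin 3) → EuclideanSpace ℝ (Fin 3)} (hw : Differentiable ℝ w)
    (x : EuclideanSpace ℝ (Fin 3)) (z : ℝ) :
    HasDerivAt (fun z : ℝ => w (x + z • EuclideanSpace.single 2 (1 : ℝ)))
      (fderiv ℝ w (x + z • EuclideanSpace.single 2 (1 : ℝ)) (EuclideanSpace.single 2 (1 : ℝ))) z := by
  have hl : HasDerivAt (fun z : ℝ => x + z • EuclideanSpace.single 2 (1 : ℝ)) (EuclideanSpace.single 2 (1 : ℝ)) z := by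
    simpa using ((hasDerivAt_id z).smul_const (EuclideanSpace.single 2 (1 : ℝ))).const_add x
  exact (hw _).hasFDerivAt.comp_hasDerivAt z hl

/-- Derivative along the vertical line for a scalar function. -/
theorem hasDerivAt_vertical {F : EuclideanSpace ℝ (Fin 3) → ℝ} (hF : Differentiable ℝ F) (x : EuclideanSpace ℝ (Fin 3)) (z : ℝ) :
    HasDerivAt (fun z : ℝ => F (x + z • EuclideanSpace.single 2 (1 : ℝ)))
      (fderiv ℝ F (x + z • EuclideanSpace.single 2 (1 : ℝ)) (EuclideanSpace.single 2 (1 : ℝ))) z := by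
  have hl : HasDerivAt (fun z : ℝ => x + z • EuclideanSpace.single 2 (1 : ℝ)) (EuclideanSpace.single 2 (1 : ℝ)) z := by
    simpa using ((hasDerivAt_id z).smul_const (EuclideanSpace.single 2 (1 : ℝ))).const_add x
  exact (hF _).hasFDerivAt.comp_hasDerivAt z hl

/-- **A z-FLAT SLAB KILLS THE PROFILE.**  See the module docstring. -/
theorem false_of_flatSlab (hdec : HasTypeITimeDecay C v) (hcont : ContinuousOn (uncurry v) (Iio (0 : ℝ) ×ˢ univ))
    (hmild : ∀ s t : ℝ, s < t → t < 0 → ∀ x, v t x = heatExtension (v s) (t - s) x - oseenDuhamel 1 s v v t x)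
    (hdiv : ∀ t < 0, VectorCalculus.IsDivFree (v t))
    (hpin : ∃ t₀ : ℝ, t₀ < 0 ∧ ∃ x₀ : EuclideanSpace ℝ (Fin 3),
      fderiv ℝ (v t₀) x₀ (EuclideanSpace.single 2 1) 0 ≠ 0 ∨ fderiv ℝ (v t₀) x₀ (EuclideanSpace.single 2 1) 1 ≠ 0)
    (hflat : ∀ᶠ z in 𝓝 (0 : ℝ), ∀ x : EuclideanSpace ℝ (Fin 3), x 2 = z → ∀ b : Fin 3, b ≠ 2 →
      fderiv ℝ (v (-1)) x (EuclideanSpace.single 2 1) b = 0) : False := by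
  have hs : (-1 : ℝ) < 0 := by norm_num
  set e₂ : EuclideanSpace ℝ (Fin 3) := EuclideanSpace.single 2 (1 : ℝ) with he₂
  have hA : IsTypeIAncientMild C v := isTypeIAncientMild_of_class hdec hcont hmild hdiv
  have hC : 0 ≤ C := hA.nonneg
  have hVd : ∀ {t : ℝ}, t < 0 → Differentiable ℝ (v t) := fun ht => (hA.contDiff_slice ht).differentiable (by simp)
  -- Step A: the vertical shear components `b ≠ 2` vanish on the whole slice
  obtain ⟨δ, hδ, hB⟩ := Metric.eventually_nhds_iff.1 hflat
  have hfb : ∀ b : Fin 3, b ≠ 2 → ∀ x : EuclideanSpace ℝ (Fin 3), fderiv ℝ (v (-1)) x e₂ b = 0 := by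
    intro b hb
    have han : AnalyticOnNhd ℝ (fun x : EuclideanSpace ℝ (Fin 3) => fderiv ℝ (v (-1)) x e₂ b) univ := by
      intro x _
      have h1 := analyticOnNhd_uncurry_fderiv_entry hdec hcont hmild 2 b ((-1 : ℝ), x) ⟨hs, mem_univ _⟩
      have hι : AnalyticAt ℝ (fun x : EuclideanSpace ℝ (Fin 3) => (((-1 : ℝ), x) : ℝ × EuclideanSpace ℝ (Fin 3))) x :=
        analyticAt_const.prod analyticAt_id
      have h2 := h1.comp_of_eq hι rfl
      simpa [Function.comp_def, he₂] using h2
    have hev : (fun x : EuclideanSpace ℝ (Fin 3) => fderiv ℝ (v (-1)) x e₂ b) =ᶠ[𝓝 0] 0 := by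
      have hopen : IsOpen {x : EuclideanSpace ℝ (Fin 3) | |x 2| < δ} :=
        isOpen_lt (continuous_abs.comp (EuclideanSpace.proj (2 : Fin 3)).continuous) continuous_const
      have hmem : (0 : EuclideanSpace ℝ (Fin 3)) ∈ {x : EuclideanSpace ℝ (Fin 3) | |x 2| < δ} := by simp [hδ]
      filter_upwards [hopen.mem_nhds hmem] with x hx
      have h := hB (y := x 2) (by simpa [dist_zero_right] using hx) x rfl b hb
      simpa [he₂] using h
    have h := han.eqOn_zero_of_preconnected_of_eventuallyEq_zero isPreconnected_univ (mem_univ 0) hev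
    exact fun x => h (mem_univ x)
  -- Step B: the components `b ≠ 2` are invariant along vertical lines
  have hFb : ∀ b : Fin 3, b ≠ 2 → ∀ x : EuclideanSpace ℝ (Fin 3), ∀ z : ℝ, v (-1) (x + z • e₂) b = v (-1) x b := by
    intro b hb x z
    have hd : Differentiable ℝ (fun y : EuclideanSpace ℝ (Fin 3) => v (-1) y b) := fun y =>
      ((differentiableAt_piLp 2).1 (hVd hs y)) b
    have hline : ∀ z : ℝ, deriv (fun z : ℝ => v (-1) (x + z • e₂) b) z = 0 := by
      intro z
      rw [(hasDerivAt_vertical hd x z).deriv, fderiv_coord_apply (hVd hs _) b]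
      exact hfb b hb _
    have hdl : Differentiable ℝ (fun z : ℝ => v (-1) (x + z • e₂) b) := fun z => (hasDerivAt_vertical hd x z).differentiableAt
    have h := is_const_of_deriv_eq_zero hdl hline z 0
    simpa using h
  -- Step C: `∂₂v₂(−1,·)` is invariant along vertical lines (incompressibility)
  have hc : ∀ x : EuclideanSpace ℝ (Fin 3), ∀ z : ℝ, fderiv ℝ (v (-1)) (x + z • e₂) e₂ 2 = fderiv ℝ (v (-1)) x e₂ 2 := by
    intro x z
    have hd0 := div_coord (hdiv (-1) hs) (x + z • e₂)
    have hd1 := div_coord (hdiv (-1) hs) x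
    have hshift : ∀ b : Fin 3, b ≠ 2 → fderiv ℝ (v (-1)) (x + z • e₂) (EuclideanSpace.single b (1 : ℝ)) b =
        fderiv ℝ (v (-1)) x (EuclideanSpace.single b (1 : ℝ)) b := by
      intro b hb
      have hfun : (fun y : EuclideanSpace ℝ (Fin 3) => v (-1) (y + z • e₂) b) = fun y => v (-1) y b := funext fun y => hFb b hb y z
      rw [← fderiv_coord_apply (hVd hs _) b, ← fderiv_coord_apply (hVd hs _) b]
      have h : fderiv ℝ (fun y : EuclideanSpace ℝ (Fin 3) => v (-1) (y + z • e₂) b) x =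
          fderiv ℝ (fun y : EuclideanSpace ℝ (Fin 3) => v (-1) y b) (x + z • e₂) :=
        fderiv_comp_add_right (𝕜 := ℝ) (f := fun y : EuclideanSpace ℝ (Fin 3) => v (-1) y b) (z • e₂)
      rw [hfun] at h
      rw [← h]
    have h0 := hshift 0 (by decide)
    have h1 := hshift 1 (by decide)
    simp only [he₂] at hd0 hd1 h0 h1 ⊢
    linarith
  -- Step D: `v₂(−1,·)` is affine, bounded, hence invariant along vertical lines
  have hF2 : ∀ x : EuclideanSpace ℝ (Fin 3), ∀ z : ℝ, v (-1) (x + z • e₂) 2 = v (-1) x 2 := by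
    intro x z
    have hd : Differentiable ℝ (fun y : EuclideanSpace ℝ (Fin 3) => v (-1) y 2) := fun y =>
      ((differentiableAt_piLp 2).1 (hVd hs y)) 2
    set cx : ℝ := fderiv ℝ (v (-1)) x e₂ 2 with hcx
    -- `g(z) = v₂(x + z e₂) − cx·z` is constant
    have hg : ∀ z : ℝ, HasDerivAt (fun z : ℝ => v (-1) (x + z • e₂) 2 - cx * z) 0 z := by
      intro z
      have h1 := hasDerivAt_vertical hd x z
      rw [fderiv_coord_apply (hVd hs _) 2, hc x z] at h1
      have h2 := h1.sub ((hasDerivAt_id z).const_mul cx)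
      rw [← hcx, mul_one, sub_self] at h2
      exact h2
    have hconst : ∀ z : ℝ, v (-1) (x + z • e₂) 2 - cx * z = v (-1) x 2 := by
      intro z
      have h := is_const_of_deriv_eq_zero (fun z => (hg z).differentiableAt) (fun z => (hg z).deriv) z 0
      simpa using h
    -- boundedness forces `cx = 0`
    have hbd : ∀ y : EuclideanSpace ℝ (Fin 3), |v (-1) y 2| ≤ C := by
      intro y
      have h := hdec (-1) hs y
      rw [neg_neg, Real.sqrt_one, div_one] at h
      exact (le_of_eq (Real.norm_eq_abs _).symm).trans ((PiLp.norm_apply_le (v (-1) y) 2).trans h)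
    have hcx0 : cx = 0 := by
      by_contra hne
      set z : ℝ := (2 * C + 1) / cx with hz
      have h1 := hconst z
      have hz' : cx * z = 2 * C + 1 := by rw [hz]; field_simp
      have ha := hbd (x + z • e₂)
      have hb := hbd x
      rw [abs_le] at ha hb
      linarith [ha.1, ha.2, hb.1, hb.2]
    have h := hconst z
    rw [hcx0, zero_mul, sub_zero] at h
    exact h
  -- Step E: the slice is invariant under vertical translations
  have hslice : ∀ h : ℝ, (fun x : EuclideanSpace ℝ (Fin 3) => v (-1) (x + h • e₂)) = v (-1) := by
    intro h
    funext x
    ext i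
    by_cases hi : i = 2
    · subst hi; exact hF2 x h
    · exact hFb i hi x h
  -- Step F: forward uniqueness on `(−1, −1/2)` for the vertical translate
  have hfwd : ∀ h : ℝ, ∀ t ∈ Ioo (-1 : ℝ) (-1 / 2), ∀ x : EuclideanSpace ℝ (Fin 3), v t (x + h • e₂) = v t x := by
    intro h
    obtain ⟨hdec', hcont', hmild'⟩ := class_translate hdec hcont hmild (h • e₂)
    have hA' : IsTypeIAncientMild C (fun t x => v t (x + h • e₂)) := by
      refine isTypeIAncientMild_of_class hdec' hcont' hmild' ?_
      exact fun t ht => isDivFree_translate_arg (hdiv t ht) (h • e₂)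
    set M : ℝ := C / Real.sqrt (1 / 2) with hM
    have hM0 : 0 ≤ M := by positivity
    have hbound : ∀ (w : ℝ → EuclideanSpace ℝ (Fin 3) → EuclideanSpace ℝ (Fin 3)), HasTypeITimeDecay C w →
        ∀ τ ∈ Ioo (-1 : ℝ) (-1 / 2), ∀ y, ‖w τ y‖ ≤ M := by
      intro w hw τ hτ y
      have h1 := hw τ (by linarith [hτ.2]) y
      have hsq : Real.sqrt (1 / 2) ≤ Real.sqrt (-τ) := Real.sqrt_le_sqrt (by linarith [hτ.2])
      have hpos : 0 < Real.sqrt (1 / 2) := Real.sqrt_pos.2 (by norm_num)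
      exact h1.trans (div_le_div_of_nonneg_left hC hpos hsq)
    have hsub : Ioo (-1 : ℝ) (-1 / 2) ×ˢ (univ : Set (EuclideanSpace ℝ (Fin 3))) ⊆ Iio 0 ×ˢ univ :=
      prod_mono (fun τ hτ => by simp only [mem_Iio]; linarith [hτ.2]) le_rfl
    have hmeas : MeasurableSet (Ioo (-1 : ℝ) (-1 / 2) ×ˢ (univ : Set (EuclideanSpace ℝ (Fin 3)))) :=
      measurableSet_Ioo.prod MeasurableSet.univ
    have hae := oseenMild_bounded_unique (ν := 1) (s := -1) (T := -1 / 2) (M := M) one_pos hM0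
      (U := fun t x => heatExtension (v (-1)) (t - (-1)) x)
      ((hcont.mono hsub).aestronglyMeasurable hmeas) ((hcont'.mono hsub).aestronglyMeasurable hmeas)
      (hbound v hdec) (hbound _ hdec')
      (fun t ht => Eventually.of_forall fun x => hmild (-1) t ht.1 (by linarith [ht.2]) x)
      (fun t ht => Eventually.of_forall fun x => by
        have h1 := hmild' (-1) t ht.1 (by linarith [ht.2]) x
        simp only at h1
        rw [hslice h] at h1
        exact h1)
    intro t ht x
    have h1 : v t =ᵐ[volume] fun x => v t (x + h • e₂) := hae t ht
    have hc1 : Continuous (v t) := hA.continuous_slice (by linarith [ht.2])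
    have hc2 : Continuous (fun x => v t (x + h • e₂)) := hA'.continuous_slice (by linarith [ht.2])
    have h2 := (Continuous.ae_eq_iff_eq volume hc1 hc2).1 h1
    exact (congrFun h2 x).symm
  -- Step G: real-analyticity in time propagates the invariance to every `t < 0`
  have hall : ∀ h : ℝ, ∀ t : ℝ, t < 0 → ∀ x : EuclideanSpace ℝ (Fin 3), v t (x + h • e₂) = v t x := by
    intro h t ht x
    have han : AnalyticOnNhd ℝ (fun σ : ℝ => v σ (x + h • e₂) - v σ x) (Iio 0) :=
      (hA.analyticOnNhd_time (x + h • e₂)).sub (hA.analyticOnNhd_time x)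
    have hev : (fun σ : ℝ => v σ (x + h • e₂) - v σ x) =ᶠ[𝓝 (-3 / 4 : ℝ)] 0 := by
      filter_upwards [Ioo_mem_nhds (show (-1 : ℝ) < -3 / 4 by norm_num) (show (-3 / 4 : ℝ) < -1 / 2 by norm_num)] with σ hσ
      simp [hfwd h σ hσ x]
    have h0 := han.eqOn_zero_of_preconnected_of_eventuallyEq_zero isPreconnected_Iio (by norm_num : (-3 / 4 : ℝ) ∈ Iio 0) hev ht
    simpa [sub_eq_zero] using h0
  -- Step H: the window pin is violated
  obtain ⟨t₀, ht₀, x₀, hx₀⟩ := hpin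
  have hconst : ∀ z : ℝ, v t₀ (x₀ + z • e₂) = v t₀ x₀ := fun z => hall z t₀ ht₀ x₀
  have hD : HasDerivAt (fun z : ℝ => v t₀ (x₀ + z • e₂)) (fderiv ℝ (v t₀) x₀ e₂) 0 := by
    simpa using hasDerivAt_vertical_vec (hVd ht₀) x₀ 0
  have hD0 : HasDerivAt (fun z : ℝ => v t₀ (x₀ + z • e₂)) 0 0 := by
    have : (fun z : ℝ => v t₀ (x₀ + z • e₂)) = fun _ => v t₀ x₀ := funext hconst
    rw [this]; exact hasDerivAt_const 0 _
  have hzero : fderiv ℝ (v t₀) x₀ e₂ = 0 := hD.unique hD0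
  rcases hx₀ with h0 | h1
  · exact h0 (by simp only [hzero]; rfl)
  · exact h1 (by simp only [hzero]; rfl)

end Summit.NavierStokesRegularity.NavierStokesRegularity.Theorems.PoloidalWindowDoorLrcModEntireTwistingTHFlatSlab
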